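import Summits.BirchSwinnertonDyer.Rank1Residual.AdditivePotMult.Exactness
import Literature.NumberTheory.EllipticCurves.BSDQuadraticDescentTorsionOddPartProofs
import Literature.NumberTheory.EllipticCurves.Rank1Residual.Typed.CasselsLowerBound
import Literature.NumberTheory.EllipticCurves.Rank1Residual.Typed.KolyvaginCertificate
import Literature.NumberTheory.EllipticCurves.Rank1Residual.Predicates
import HarnessLib

/-!
# Rank ZERO at an additive (indeed ANY) odd prime with `ord_p #Ш(E)_an = 2k`: Kolyvagin's Heegner-index BOUND `ord_p [E(K):ℤy_K] ≤ k` is the missing UPPER half; with the descent certificate `p^{2k−1} ∣ #Ш(E)` it gives `BSD(E,p)` (cell `b2b-bsdres`, sub-cell additive-p1, gen 5)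

HONEST FRAMING (cell `b2b-bsdres`, run/shared/lean/b2b/bsd-rank1-residual/, verbatim in every
file): the goal of the cell is to DELETE the COMBINATION-SHAPED residual classes of the
Birch–Swinnerton-Dyer formula for ALL analytic-rank `≤ 1` elliptic curves over `ℚ` — "full BSD
formula for every rank `≤ 1` curve in class `C`" assembled STRICTLY from published theorems — so
that the rank-`≤ 1` remainder becomes exactly the CONSTRUCTION-SHAPED classes, which are TYPED
(missing-input `Prop`s), NOT attempted. This is not "finishing BSD". Sub-cell additive-p1 is a
RESEARCH ROUTE on the construction-shaped classes X3♯(M) / X4(M) (additive, potentially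
multiplicative `p`); no claim beyond the stated sub-classes; X3/X4 labels are UNCHANGED by this file;
NOTHING is booked here (a per-pair closure is the referee's ruling on the lane's certificates).

THEOREMS ONLY (no definition, no named fact). PER PAIR (a certificate shape), not a class theorem.

## What this file records

The cell's census of record for X4 at `p = 3`, rank `0` (sha-2 seat, `verdicts_oddp.tsv` of
2026-08-20; `N < 2·10⁴`) leaves EXACTLY 74 pairs `RESISTANT`, all with the SAME verbatim reason:
"`Ш(E)[3] = (ℤ/3)²` certified (`dim Sel³ = 2`, `r = 0`); exact order not pinned by a first descent:
`3` additive (Wuthrich Prop. 21 excludes additive `p`)" — every one of them with `#Ш(E)_an = 9`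
(one `= 81`) and `ρ̄_{E,3}` onto; 54 of the 74 are X4(M) (potentially multiplicative, this sub-cell),
15 potentially supersingular, 5 potentially good ordinary (this seat's `census-g5/x4m_map.json`). The
LOWER half is thus a certificate already on file; the missing UPPER half `ord_3 #Ш(E) ≤ 2` has, at an
ADDITIVE prime, no published Iwasawa-theoretic source (Kato's Thm. 14.5(3) excludes weight-2
potentially multiplicative `p`; Kim 2026 needs `p ≥ 5`; Wuthrich Prop. 21 / Cha 2005 need `p² ∤ N`;
the cell's χ-branch input [B∘C] is typed). KOLYVAGIN supplies it PER PAIR: the tree's PUBLISHED fact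
`Kolyvagin1990_padicValNat_card_sha_le` (McCallum, LMS LN 153 (1991) §1 p. 296 / Gross, ibid.
Thm. 1.3: for `p` odd with `ρ̄_{E,p}` onto and a Heegner point `y_K` of infinite order,
`ord_p #Ш(E/K) ≤ 2·ord_p [E(K):ℤ y_K]` — NO hypothesis on the reduction of `E` at `p`), together with
`Ш(E/ℚ)[p^∞] ↪ Ш(E/K)[p^∞]` for `p` odd (here in the exact form
`ord_p #Ш(E/K) = ord_p #Ш(E) + ord_p #Ш(E^{d_K})`, this sub-cell's `padicValNat_shaOrder_baseChange`,
Dokchitser–Dokchitser 2010 Lemma 4.14), turns a Heegner-index certificate `ord_p [E(K):ℤP] ≤ k` into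
`ord_p #Ш(E) ≤ 2k`. This is the ADDITIVE-prime twin of the cell's `Typed.bsdp_of_wuthrich_of_casselsTate_of_pow_dvd`
(x11b gen 3: Wuthrich's upper half + Cassels–Tate lower certificate, NON-additive `p`) and of x10b's
Jetchev–Cha route on X10b (Cha's index bound, `p² ∤ N`): here the upper half is Kolyvagin's, valid at
every reduction type, at the price of surjectivity (automatic on X4 ∧ {`p ≥ 5` or (ram)}; a census
bit `surj(3)` at `p = 3`, true on all 74 pairs).

* `padicValNat_shaOrder_le_of_indexBound` — rank `≤ 1`… in fact ANY `W`: `p` odd, `ρ̄` onto, `K`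
  imaginary quadratic Heegner for the level `N`, `P` a Heegner point of infinite order,
  `ord_p [E(K):ℤP] ≤ k` ⟹ `Ш(E/ℚ)` finite and `ord_p #Ш(E/ℚ) ≤ 2k`.
* `missingUpperBoundAt_of_indexBound` — with `#Ш(E)_an = q`, `2k ≤ ord_p q`: the typed UPPER half.
* `bsdp_rankZero_of_indexBound_of_pow_dvd` — rank `0`, `ord_p q = 2k`, index bound `≤ k`, and the
  descent certificate `p^{2k−1} ∣ #Ш(E)` (Cassels–Tate squareness `hCT` makes it `p^{2k}`):
  `BSDp W p`. `…_of_exists_torsion` — the `k = 1` shape met in the census (`#Ш_an = p²`, ONE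
  certificate `Ш(E)[p] ≠ 0`, ONE Heegner field with `ord_p [E(K):ℤP] ≤ 1`).
* `ClassX4.bsdp_three_rankZero_of_indexBound_of_exists_torsion` — the X4 ∧ `p = 3` reading.

Expected reach (Gross–Zagier + the BSD shape, not a theorem): `ord_p [E(K):ℤP] = k` exactly when
the rank-one twist `E^{d_K}` has `p ∤ #Ш(E^{d_K})·(its Tamagawa/torsion terms)` and `p ∤ ∏c_ℓ(E)`
(69 of the 74 pairs have `3 ∤ ∏c_ℓ(E)`); the certificate is the lane's two-engine Heegner-index row
(X9 g7 / x11c g3 / x10b engines, rank-`0` path: a rational point on the rank-one twist, Gross–Zagier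
height, `m = √(4ρ)`, `ord_p m`). NOTHING is booked by this file; X4 stays CONSTRUCTION-SHAPED.

References: [McCallumLMS1991] §1; [GrossLMS1991] Thm. 1.3 / Prop. 2.1; [Kolyvagin1990] Thm. A;
[DokchitserDokchitserAnnals2010] Lemma 4.14; [SilvermanAEC2009] X.4.14 (Cassels–Tate);
[Miller2011LMS] Def. 1.1; [Wuthrich2014] Prop. 21 (the excluded additive case);
[GrigorovJorzaPatrikisSteinTarnita2009] p. 2406.
-/

noncomputable section

open scoped Classical NumberField

open WeierstrassCurve NumberField Literature.NumberTheory.EllipticCurves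
  Literature.NumberTheory.EllipticCurves.Rank1Residual
  Literature.NumberTheory.EllipticCurves.Rank1Residual.Typed

namespace Summit.BirchSwinnertonDyer.Rank1Residual.AdditivePotMult

/-! ### §1 The upper half from Kolyvagin's index bound, any odd `p`, any reduction type -/

/-- **`ord_p #Ш(E/ℚ) ≤ 2k` from a Heegner-index bound `ord_p [E(K):ℤP] ≤ k`, ANY odd `p` with
`ρ̄_{E,p}` onto, ANY reduction type at `p`.** `K` imaginary quadratic with the Heegner hypothesis
for the level `N`; `P ∈ E(K)` a Heegner point of infinite order. Kolyvagin (PUBLISHED facts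
`kolyvagin` `hKo`: `Ш(E/K)` finite; `Kolyvagin1990_padicValNat_card_sha_le` `hB`:
`ord_p #Ш(E/K) ≤ 2·ord_p [E(K):ℤP]`) and `ord_p #Ш(E/K) = ord_p #Ш(E) + ord_p #Ш(E^{d_K})` for odd
`p` (`padicValNat_shaOrder_baseChange`; finiteness of `Ш(E)`, `Ш(E^{d_K})` descends from `Ш(E/K)`).
Per pair. [cite: McCallumLMS1991, §1 Theorem (Kolyvagin), p. 296] [cite: GrossLMS1991, Thm. 1.3]
[cite: DokchitserDokchitserAnnals2010, Lemma 4.14] -/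
theorem padicValNat_shaOrder_le_of_indexBound
    (W : WeierstrassCurve ℚ) [W.IsElliptic] (p : ℕ) [Fact p.Prime]
    {N : ℕ} [NeZero N] {K : Type} [Field K] [NumberField K]
    (hKo : kolyvagin N W K) (hB : Kolyvagin1990_padicValNat_card_sha_le N W K)
    (hK : IsImaginaryQuadratic K) (hH : SatisfiesHeegnerHypothesis N K)
    {P : (W.baseChange K).toAffine.Point} (hP : IsHeegnerPoint N W K P) (hnt : ¬ IsOfFinAddOrder P)
    (hp2 : p ≠ 2) (hsurj : Surj W p) {k : ℕ}
    (hI : padicValNat p (AddSubgroup.zmultiples P).index ≤ k) :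
    W.ShaFinite ∧ padicValNat p W.shaOrder ≤ 2 * k := by
  have hp : p.Prime := Fact.out
  obtain ⟨-, hfinK⟩ := hKo hK hH hP hnt
  -- the twist model and finiteness downstairs
  have hD0 : (NumberField.discr K : ℚ) ≠ 0 := by exact_mod_cast NumberField.discr_ne_zero K
  haveI hEt : (W.quadraticTwist (NumberField.discr K : ℚ)).IsElliptic :=
    W.isElliptic_quadraticTwist hD0
  have hWd : (1 : VariableChange ℚ) • W.quadraticTwist (NumberField.discr K : ℚ) =
      W.quadraticTwist (NumberField.discr K : ℚ) := one_smul _ _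
  have hW' : (1 : VariableChange K) • W.baseChange K = W.baseChange K := one_smul _ _
  haveI : (W.baseChange K).IsElliptic := by rw [WeierstrassCurve.baseChange]; infer_instance
  have hfinW : W.ShaFinite := W.shaFinite_of_shaFinite_smul_baseChange K hW' hfinK
  have hfinD : (W.quadraticTwist (NumberField.discr K : ℚ)).ShaFinite :=
    W.shaFinite_twist_of_shaFinite_smul_baseChange K hK.1 hWd hW' hfinK
  -- `ord_p #Ш(E/K) = ord_p #Ш(E) + ord_p #Ш(E^{d_K})`
  have hsum := padicValNat_shaOrder_baseChange W p K (W.quadraticTwist (NumberField.discr K : ℚ))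
    (W.baseChange K) hp2 hK.1 ⟨1, hWd⟩ ⟨1, hW'⟩ hfinW hfinD hfinK
  -- Kolyvagin's bound
  have hbound := hB hK hH hP hnt hp hp2 hsurj
  refine ⟨hfinW, ?_⟩
  have hK' : padicValNat p (W.baseChange K).shaOrder ≤ 2 * k := by
    unfold WeierstrassCurve.shaOrder
    exact hbound.trans (Nat.mul_le_mul_left 2 hI)
  omega

/-- **The typed UPPER half `ord_p #Ш(E) ≤ ord_p #Ш(E)_an` from the index bound** (same data; with
`#Ш(E)_an = q ∈ ℚ` and `2k ≤ ord_p q`). Per pair. [cite: McCallumLMS1991, §1 Theorem (Kolyvagin), p. 296]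
[cite: Miller2011LMS, Def. 1.1] -/
theorem missingUpperBoundAt_of_indexBound
    (W : WeierstrassCurve ℚ) [W.IsElliptic] (p : ℕ) [Fact p.Prime]
    {N : ℕ} [NeZero N] {K : Type} [Field K] [NumberField K]
    (hKo : kolyvagin N W K) (hB : Kolyvagin1990_padicValNat_card_sha_le N W K)
    (hK : IsImaginaryQuadratic K) (hH : SatisfiesHeegnerHypothesis N K)
    {P : (W.baseChange K).toAffine.Point} (hP : IsHeegnerPoint N W K P) (hnt : ¬ IsOfFinAddOrder P)
    (hp2 : p ≠ 2) (hsurj : Surj W p) {k : ℕ}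
    (hI : padicValNat p (AddSubgroup.zmultiples P).index ≤ k)
    {q : ℚ} (hq : shaAn W = (q : ℂ)) (hv : (2 * k : ℤ) ≤ padicValRat p q) :
    MissingUpperBoundAt W p := by
  obtain ⟨-, hle⟩ := padicValNat_shaOrder_le_of_indexBound W p hKo hB hK hH hP hnt hp2 hsurj hI
  refine ⟨q, hq, le_trans ?_ hv⟩
  exact_mod_cast hle

/-! ### §2 Rank zero: `BSD(E,p)` from the index bound and the descent certificate -/

/-- **Rank `0`, ANY odd `p` (additive included), `ρ̄` onto, `ord_p #Ш(E)_an = 2k`: the index bound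
`ord_p [E(K):ℤP] ≤ k` (upper half, Kolyvagin) and the descent certificate `p^{2k−1} ∣ #Ш(E/ℚ)` (lower
half, Cassels–Tate squareness `hCT`) give `BSD(E,p)`.** `K`, `P` as in §1; `Ш(E)` finite and
`rank E(ℚ) = 0` by Gross–Zagier–Kolyvagin (`hGZK`). The additive-prime twin of the cell's
`Typed.bsdp_of_wuthrich_of_casselsTate_of_pow_dvd` (Wuthrich Prop. 21 excludes additive `p`). Per
pair; nothing booked. [cite: McCallumLMS1991, §1 Theorem (Kolyvagin), p. 296]
[cite: SilvermanAEC2009, Thm. X.4.14] [cite: Miller2011LMS, §1 and Def. 1.1] -/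
theorem bsdp_rankZero_of_indexBound_of_pow_dvd
    (W : WeierstrassCurve ℚ) [W.IsElliptic] (p : ℕ) [Fact p.Prime]
    (hCT : exists_casselsTate_pairing (K := ℚ)) (hGZK : rank_eq_analyticRank_of_analyticRank_le_one)
    {N : ℕ} [NeZero N] {K : Type} [Field K] [NumberField K]
    (hKo : kolyvagin N W K) (hB : Kolyvagin1990_padicValNat_card_sha_le N W K)
    (hK : IsImaginaryQuadratic K) (hH : SatisfiesHeegnerHypothesis N K)
    {P : (W.baseChange K).toAffine.Point} (hP : IsHeegnerPoint N W K P) (hnt : ¬ IsOfFinAddOrder P)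
    (hp2 : p ≠ 2) (hsurj : Surj W p) (hr : W.analyticRank = 0) {k : ℕ}
    (hI : padicValNat p (AddSubgroup.zmultiples P).index ≤ k)
    {q : ℚ} (hq : shaAn W = (q : ℂ)) (hv : padicValRat p q = 2 * k)
    (hdvd : p ^ (2 * k - 1) ∣ W.shaOrder) : BSDp W p := by
  obtain ⟨hfin, hle⟩ := padicValNat_shaOrder_le_of_indexBound W p hKo hB hK hH hP hnt hp2 hsurj hI
  -- lower half: Cassels–Tate squareness and the certificate
  obtain ⟨q', hq', hlow⟩ :=
    missingLowerBoundAt_of_casselsTate_of_pow_dvd W p hCT hfin hq (k := k) (le_of_eq hv) hdvd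
  have hqq : q' = q := by exact_mod_cast hq'.symm.trans hq
  subst hqq
  refine bsdp_of_missingPPartAt W p hGZK (by rw [hr]; norm_num) ⟨q', hq', le_antisymm hlow ?_⟩
  rw [hv]; exact_mod_cast hle

/-- **The `k = 1` shape met in the census (`#Ш(E)_an = p²·unit`): ONE descent certificate
`Ш(E/ℚ)[p] ≠ 0` and ONE Heegner field with `ord_p [E(K):ℤP] ≤ 1`** ⟹ `BSD(E,p)` (rank `0`, odd `p`,
`ρ̄` onto, any reduction type). Per pair; nothing booked. [cite: McCallumLMS1991, §1 Theorem (Kolyvagin), p. 296]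
[cite: SilvermanAEC2009, Thm. X.4.14] [cite: Miller2011LMS, §1 and Def. 1.1] -/
theorem bsdp_rankZero_of_indexBound_of_exists_torsion
    (W : WeierstrassCurve ℚ) [W.IsElliptic] (p : ℕ) [Fact p.Prime]
    (hCT : exists_casselsTate_pairing (K := ℚ)) (hGZK : rank_eq_analyticRank_of_analyticRank_le_one)
    {N : ℕ} [NeZero N] {K : Type} [Field K] [NumberField K]
    (hKo : kolyvagin N W K) (hB : Kolyvagin1990_padicValNat_card_sha_le N W K)
    (hK : IsImaginaryQuadratic K) (hH : SatisfiesHeegnerHypothesis N K)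
    {P : (W.baseChange K).toAffine.Point} (hP : IsHeegnerPoint N W K P) (hnt : ¬ IsOfFinAddOrder P)
    (hp2 : p ≠ 2) (hsurj : Surj W p) (hr : W.analyticRank = 0)
    (hI : padicValNat p (AddSubgroup.zmultiples P).index ≤ 1)
    {q : ℚ} (hq : shaAn W = (q : ℂ)) (hv : padicValRat p q = 2)
    (htor : ∃ x : W.sha, x ≠ 0 ∧ p • x = 0) : BSDp W p :=
  bsdp_rankZero_of_indexBound_of_pow_dvd W p hCT hGZK hKo hB hK hH hP hnt hp2 hsurj hr (k := 1) hI hq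
    (by rw [hv]; norm_num) (by simpa using dvd_shaOrder_of_exists_torsion W p htor)

/-! ### §3 The X4 ∧ `p = 3` reading (74 census pairs, 54 of them X4(M)) -/

variable {W : WeierstrassCurve ℚ} [W.IsElliptic]

/-- **X4 at `p = 3`, rank `0`, `#Ш(E)_an = 9·(3-adic unit)`, `ρ̄_{E,3}` onto: `BSD(E,3)` from ONE
Heegner field with `ord_3 [E(K):ℤP] ≤ 1` and the 3-descent certificate `Ш(E)[3] ≠ 0`.** The class
hypothesis is not used by the proof (the lever is class-agnostic); it is recorded because this is
where the lever bites: the 74 `RESISTANT` rank-`0` X4 pairs at `p = 3` of the census of record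
(`N < 2·10⁴`; 54 X4(M), 15 potentially supersingular, 5 potentially good ordinary) all carry
`#Ш_an = 9` (one `81`), `surj(3)`, and sha-2's certificate `Ш(E)[3] = (ℤ/3)²`. Per pair; X4 stays
CONSTRUCTION-SHAPED; nothing booked. [cite: McCallumLMS1991, §1 Theorem (Kolyvagin), p. 296]
[cite: SilvermanAEC2009, Thm. X.4.14] [cite: Miller2011LMS, §1 and Def. 1.1] -/
theorem ClassX4.bsdp_three_rankZero_of_indexBound_of_exists_torsion [Fact (Nat.Prime 3)]
    (_hX : ClassX4 W 3)
    (hCT : exists_casselsTate_pairing (K := ℚ)) (hGZK : rank_eq_analyticRank_of_analyticRank_le_one)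
    {N : ℕ} [NeZero N] {K : Type} [Field K] [NumberField K]
    (hKo : kolyvagin N W K) (hB : Kolyvagin1990_padicValNat_card_sha_le N W K)
    (hK : IsImaginaryQuadratic K) (hH : SatisfiesHeegnerHypothesis N K)
    {P : (W.baseChange K).toAffine.Point} (hP : IsHeegnerPoint N W K P) (hnt : ¬ IsOfFinAddOrder P)
    (hsurj : Surj W 3) (hr : W.analyticRank = 0)
    (hI : padicValNat 3 (AddSubgroup.zmultiples P).index ≤ 1)
    {q : ℚ} (hq : shaAn W = (q : ℂ)) (hv : padicValRat 3 q = 2)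
    (htor : ∃ x : W.sha, x ≠ 0 ∧ (3 : ℕ) • x = 0) : BSDp W 3 :=
  bsdp_rankZero_of_indexBound_of_exists_torsion W 3 hCT hGZK hKo hB hK hH hP hnt (by norm_num) hsurj
    hr hI hq hv htor

end Summit.BirchSwinnertonDyer.Rank1Residual.AdditivePotMult

end
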